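import Summits.HodgeConjecture.HodgeConjecture.Theorems.F0P3bPNullGeneration
import Mathlib.Analysis.InnerProductSpace.Basic
import Mathlib.Order.PartialSups
import HarnessLib

/-!
# Crux `H413` — RUNG 1½ «ISOTYPY FROM A NULL CORE», brick B1: in a UNITARY `(𝔤, K)`-datum of `U(α, β)` the submodule generated by a
# `K`-irreducible null core is IRREDUCIBLE, and its null vectors are exactly the core

Floor-0 programme P3 «U3-mult», seat F0P3-p02 (g3); crux item stmt-HodgeConjecture-24833 (`HCCMUnconditional.H413`); design note
`F0/P3/STATUS.md` 2026-08-31T01:1xZ (road «F1a in-house at the pin»).  HC_CM is proved only modulo the printed citations until rung 0 closes.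

Currency = the T6 layer's (★ `F0P3bPPartOperators`, ★ `F0P3bPNullGeneration`, F0P3-p01 (g2)): a pair datum `(ρK, ρ𝔤)` of `U(α, β) =
uFormGroup α β` on a complex vector space `V`, the operators `pOp ρ𝔤 c X = ρX + c ρ⁅z₀, X⁆` (`N = pOp μ` the nullity operator, `P = pOp (−μ)`
the raising operator, `μ² = −1`), a NULL CORE `E` (`hEn`: `N(x_s) E = 0`; `hEk`: `𝔨`-stable; `hEK`: `K`-stable) of `z₀`-weight `w`, its graded
pieces `grade ρ𝔤 μ E n` (`G₀ = E`, `G_{n+1} = Σ_s P(x_s) G_n ⊆ eigenspace(ρz₀, w + nμ)`) and the generated `(𝔤, K)`-submodule `gen ρ𝔤 μ E = ⨆ G_n`.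
NEW HYPOTHESIS here: `V` is an inner-product space on which `𝔤` acts by SKEW-HERMITIAN operators,
`⟪ρ𝔤 X v, w⟫ + ⟪v, ρ𝔤 X w⟫ = 0` (hypothesis `hU`; for the archimedean module of a discrete automorphic representation this is ★
`DiscreteAutomorphicRep.inner_archRepLie_add_inner_archRepLie_eq_zero`, [BorelWallach2000, 0 §2.5]).  Nothing else: no admissibility, no
finite-dimensionality of `E`, no `ad_compat`, no invariance of the inner product under `K`.

* §1 Skewness bookkeeping: `inner_pOp_left` (`⟪pOp c X v, w⟫ = −⟪v, pOp c̄ X w⟫`, so `P(X)* = −N(X)` when `μ̄ = −μ`), eigenvalues of the skew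
  operator `ρz₀` are imaginary and its eigenvectors for distinct eigenvalues are orthogonal (`inner_eq_zero_of_eigenvalue_ne`).
* §2 The filtration `partialSups (grade ρ𝔤 μ E) m = G₀ ⊔ … ⊔ G_m`: lowered by `N(X)` (`pOp_mem_partialSups`), orthogonal to `G_{m+1}`
  (`inner_eq_zero_of_mem_partialSups`), exhausting `gen` (`exists_mem_partialSups_of_mem_gen`); a null vector is orthogonal to every `G_{m+1}`
  (`inner_eq_zero_of_null`).
* §3 **`mem_core_of_null`**: a vector of `gen ρ𝔤 μ E` killed by all `N(x_s)` lies in `E` — the null vectors of the generated module are EXACTLY the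
  core (the unitary counterpart, WITHOUT irreducibility, of ★ `F0P3bPNullIrreducible.nullWeightSpace_eq_bot_of_ne`).
* §4 **`eq_bot_or_eq_gen_of_isGKSubmodule`**: if `E` has no `K`-stable subspace meeting it other than `⊥` and `E` (`hEirr`), every
  `(𝔤, K)`-submodule `W ≤ gen ρ𝔤 μ E` is `⊥` or `gen ρ𝔤 μ E`; `inf_gen_eq_bot_or_gen_le` (any `(𝔤, K)`-submodule `W` of `V`: `W ⊓ gen = ⊥` or
  `gen ≤ W`).  Proof: a non-zero `W` missing `E` contains, by lowering with `N(x_s)` inside the filtration, a non-zero NULL vector, which lies in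
  `E` by §3 — contradiction; if `W` meets `E` it contains `E` (`hEirr`) hence `gen`.  This is the «lowest `K`-type» irreducibility mechanism
  of the holomorphic discrete series ([BorelWallach2000, II §4.1–4.2]; [KnappVogan1995, §II.4]; [Rogawski1990, §15.2]) in its most elementary
  form; it is the algebraic heart of detecting the archimedean module of a `P` containing a holomorphic cotangent form by an irreducible module
  WITHOUT the letter F1a (`DiscreteAutomorphicRep.ArchIsotypy`).

No definition, no sorry, no named fact.

References: [BorelWallach2000] A. Borel, N. Wallach, 2nd ed. (2000), 0 §2.5, II §4.1–4.2; [KnappVogan1995] A. Knapp, D. Vogan, *Cohomological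
induction and unitary representations* (1995), §II.4; [Rogawski1990] J. Rogawski, Ann. of Math. Stud. 123, §15.2.
-/

-- Mathlib idiom (as in `GKModules`, `GKCohomology`, the `Upq*` files and the T6 layer): commutator bracket on `Module.End`
attribute [local instance 100] LieRing.ofAssociativeRing

set_option autoImplicit false
-- the mandated namespace repeats `HodgeConjecture.HodgeConjecture`, as in every `Theorems/*.lean` of this sub-problem
set_option linter.dupNamespace false

noncomputable section

namespace Summit.HodgeConjecture.HodgeConjecture.Cruxes.H413.F0P3GenIrreducibleOfUnitary

open Literature.Algebra.Lie Literature.Algebra.Lie.ChevalleyEilenberg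
open Literature.NumberTheory.Automorphic
open Literature.RepresentationTheory.BorelWallach2000
open Literature.RepresentationTheory.KonnoKonno2007 Literature.RepresentationTheory.KonnoKonno2007.RealDualPair
open Literature.RepresentationTheory.KonnoKonno2007.RealDualPair.UForm
open Summit.HodgeConjecture.HodgeConjecture.Cruxes.H413.F0P3bPPartOperators
open Summit.HodgeConjecture.HodgeConjecture.Cruxes.H413.F0P3bPNullGeneration
open scoped InnerProductSpace ComplexConjugate

variable {α β : Type} [Fintype α] [DecidableEq α] [Fintype β] [DecidableEq β]
variable {V : Type} [NormedAddCommGroup V] [InnerProductSpace ℂ V]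
  {ρK : Representation ℂ (uFormGroup α β).maximalCompact V} {ρ𝔤 : (uFormGroup α β).lie →ₗ⁅ℝ⁆ Module.End ℂ V}

/-! ## §1 Skew-Hermitian `𝔤`-actions: adjoints of `pOp`, imaginary `z₀`-weights, orthogonal eigenvectors -/

/-- `⟪pOp c X v, w⟫ = −⟪v, pOp c̄ X w⟫` for a skew-Hermitian `ρ𝔤`; in particular the raising operator `P(X) = pOp (−μ) X` and the nullity
operator `N(X) = pOp μ X` are minus-adjoint to each other when `μ̄ = −μ`. [cite: BorelWallach2000, 0 §2.5; II §4.1] -/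
theorem inner_pOp_left (hU : ∀ (X : (uFormGroup α β).lie) (v w : V), ⟪ρ𝔤 X v, w⟫_ℂ + ⟪v, ρ𝔤 X w⟫_ℂ = 0) (c : ℂ)
    (X : (uFormGroup α β).lie) (v w : V) : ⟪pOp ρ𝔤 c X v, w⟫_ℂ = -⟪v, pOp ρ𝔤 (conj c) X w⟫_ℂ := by
  have h1 := hU X v w
  have h2 := hU ⁅upqZ0 α β, X⁆ v w
  rw [pOp_apply, pOp_apply, inner_add_left, inner_smul_left, inner_add_right, inner_smul_right,
    eq_neg_of_add_eq_zero_left h1, eq_neg_of_add_eq_zero_left h2]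
  ring

/-- A `z₀`-eigenvalue carried by a NON-ZERO vector is imaginary: `ā = −a` (`ρz₀` is skew-Hermitian). [cite: BorelWallach2000, 0 §2.5] -/
theorem conj_eq_neg_of_eigenvector (hU : ∀ (X : (uFormGroup α β).lie) (v w : V), ⟪ρ𝔤 X v, w⟫_ℂ + ⟪v, ρ𝔤 X w⟫_ℂ = 0)
    (Z : (uFormGroup α β).lie) {a : ℂ} {v : V} (hv : ρ𝔤 Z v = a • v) (hv0 : v ≠ 0) : conj a = -a := by
  have h := hU Z v v
  rw [hv, inner_smul_left, inner_smul_right, ← add_mul] at h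
  have hvv : ⟪v, v⟫_ℂ ≠ 0 := fun h0 => hv0 (inner_self_eq_zero.mp h0)
  exact eq_neg_of_add_eq_zero_left ((mul_eq_zero.mp h).resolve_right hvv)

/-- **Eigenvectors of the skew-Hermitian `ρZ` for DISTINCT eigenvalues are orthogonal.** [cite: BorelWallach2000, 0 §2.5] -/
theorem inner_eq_zero_of_eigenvalue_ne (hU : ∀ (X : (uFormGroup α β).lie) (v w : V), ⟪ρ𝔤 X v, w⟫_ℂ + ⟪v, ρ𝔤 X w⟫_ℂ = 0)
    (Z : (uFormGroup α β).lie) {a b : ℂ} {v w : V} (hv : ρ𝔤 Z v = a • v) (hw : ρ𝔤 Z w = b • w) (hab : a ≠ b) :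
    ⟪v, w⟫_ℂ = 0 := by
  by_cases hv0 : v = 0
  · rw [hv0, inner_zero_left]
  have ha := conj_eq_neg_of_eigenvector hU Z hv hv0
  have h := hU Z v w
  rw [hv, hw, inner_smul_left, inner_smul_right, ha, ← add_mul] at h
  exact (mul_eq_zero.mp h).resolve_left (fun h0 => hab (by linear_combination -h0))

/-- `μ² = −1` forces `μ̄ = −μ` (`μ = ±i`). [folklore] -/
theorem conj_eq_neg_of_mul_self {μ : ℂ} (hμ : μ * μ = -1) : conj μ = -μ := by
  have h : (μ - Complex.I) * (μ + Complex.I) = 0 := by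
    have : (μ - Complex.I) * (μ + Complex.I) = μ * μ - Complex.I * Complex.I := by ring
    rw [this, hμ, Complex.I_mul_I, sub_self]
  rcases mul_eq_zero.mp h with h | h
  · rw [sub_eq_zero.mp h, Complex.conj_I]
  · rw [eq_neg_of_add_eq_zero_left h, map_neg, Complex.conj_I, neg_neg]

/-- `w + nμ = w + mμ` only for `n = m` (`μ ≠ 0`). [folklore] -/
theorem weight_injective {μ : ℂ} (hμ : μ * μ = -1) (w : ℂ) {n m : ℕ} (h : w + n * μ = w + m * μ) : n = m := by
  have hμ0 : μ ≠ 0 := by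
    rintro rfl
    norm_num at hμ
  have h' : (n : ℂ) * μ = m * μ := add_left_cancel h
  exact_mod_cast mul_right_cancel₀ hμ0 h'

/-! ## §2 The filtration `G₀ ⊔ ⋯ ⊔ G_m` of the generated module -/

section Filtration

variable {μ : ℂ} {E : Submodule ℂ V}

/-- `gen ρ𝔤 μ E` is exhausted by the finite stages `partialSups (grade ρ𝔤 μ E) m = G₀ ⊔ ⋯ ⊔ G_m`. [cite: BorelWallach2000, II §4.1] -/
theorem exists_mem_partialSups_of_mem_gen {v : V} (hv : v ∈ gen ρ𝔤 μ E) : ∃ m : ℕ, v ∈ partialSups (grade ρ𝔤 μ E) m := by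
  have h : gen ρ𝔤 μ E = ⨆ m, partialSups (grade ρ𝔤 μ E) m := (iSup_partialSups_eq _).symm
  rw [h] at hv
  exact (Submodule.mem_iSup_of_directed _ (partialSups (grade ρ𝔤 μ E)).monotone.directed_le).mp hv

/-- The stages lie in `gen`. [folklore] -/
theorem partialSups_le_gen (m : ℕ) : partialSups (grade ρ𝔤 μ E) m ≤ gen ρ𝔤 μ E :=
  partialSups_le _ _ _ fun n _ => grade_le_gen μ E n

/-- `G₀ ⊔ ⋯ ⊔ G_{m+1} = (G₀ ⊔ ⋯ ⊔ G_m) ⊔ G_{m+1}`. [folklore] -/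
theorem partialSups_succ' (m : ℕ) :
    partialSups (grade ρ𝔤 μ E) (m + 1) = partialSups (grade ρ𝔤 μ E) m ⊔ grade ρ𝔤 μ E (m + 1) :=
  partialSups_succ _ m

/-- **The nullity operators lower the filtration**: `N(X) (G₀ ⊔ ⋯ ⊔ G_{m+1}) ⊆ G₀ ⊔ ⋯ ⊔ G_m` and `N(X) G₀ = 0` for `X ∈ 𝔭` (★
`pOp_mem_grade`, ★ `pOp_eq_zero_of_mem_core`). [cite: BorelWallach2000, II §4.1] -/
theorem pOp_mem_partialSups (hEn : ∀ e ∈ E, ∀ s : (α × β) × Fin 2, pOp ρ𝔤 μ (upqPBasis s) e = 0)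
    (hEk : ∀ W ∈ (uFormGroup α β).kInLie, ∀ e ∈ E, ρ𝔤 W e ∈ E) (X : (uFormGroup α β).lie) (hX : X ∈ pPart α β) :
    ∀ (m : ℕ) {v : V}, v ∈ partialSups (grade ρ𝔤 μ E) (m + 1) → pOp ρ𝔤 μ X v ∈ partialSups (grade ρ𝔤 μ E) m := by
  intro m
  induction m with
  | zero =>
    intro v hv
    rw [partialSups_succ', partialSups_zero, Submodule.mem_sup] at hv
    obtain ⟨y, hy, z, hz, rfl⟩ := hv
    rw [partialSups_zero, LinearMap.map_add, grade_zero, pOp_eq_zero_of_mem_core hEn X hX hy, zero_add]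
    exact pOp_mem_grade hEn hEk 0 hz X hX
  | succ m ih =>
    intro v hv
    rw [partialSups_succ', Submodule.mem_sup] at hv
    obtain ⟨y, hy, z, hz, rfl⟩ := hv
    rw [partialSups_succ', LinearMap.map_add]
    exact Submodule.add_mem_sup (ih hy) (pOp_mem_grade hEn hEk (m + 1) hz X hX)

/-- **The stage `G₀ ⊔ ⋯ ⊔ G_m` is orthogonal to `G_{m+1}`** (and to every `G_k`, `k > m`): different `z₀`-weights (`grade n ⊆ eigenspace(w + nμ)`,
★ `z0_apply_of_mem_grade`) of a skew-Hermitian operator. [cite: BorelWallach2000, 0 §2.5; II §4.1] -/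
theorem inner_eq_zero_of_mem_partialSups (hU : ∀ (X : (uFormGroup α β).lie) (v w : V), ⟪ρ𝔤 X v, w⟫_ℂ + ⟪v, ρ𝔤 X w⟫_ℂ = 0)
    (hμ : μ * μ = -1) {w : ℂ} (hw : ∀ e ∈ E, ρ𝔤 (upqZ0 α β) e = w • e) :
    ∀ (m : ℕ) {u : V}, u ∈ partialSups (grade ρ𝔤 μ E) m → ∀ (k : ℕ), m < k → ∀ {v : V}, v ∈ grade ρ𝔤 μ E k → ⟪u, v⟫_ℂ = 0 := by
  intro m
  induction m with
  | zero =>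
    intro u hu k hk v hv
    rw [partialSups_zero] at hu
    refine inner_eq_zero_of_eigenvalue_ne hU (upqZ0 α β) (z0_apply_of_mem_grade hμ hw 0 hu) (z0_apply_of_mem_grade hμ hw k hv) ?_
    exact fun h => (Nat.ne_of_lt hk) (weight_injective hμ w h)
  | succ m ih =>
    intro u hu k hk v hv
    rw [partialSups_succ', Submodule.mem_sup] at hu
    obtain ⟨y, hy, z, hz, rfl⟩ := hu
    rw [inner_add_left, ih hy k ((Nat.lt_succ_self m).trans hk) hv, zero_add]
    refine inner_eq_zero_of_eigenvalue_ne hU (upqZ0 α β) (z0_apply_of_mem_grade hμ hw (m + 1) hz) (z0_apply_of_mem_grade hμ hw k hv) ?_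
    exact fun h => (Nat.ne_of_lt hk) (weight_injective hμ w h)

/-- **A NULL vector is orthogonal to every `G_{m+1}`**: `G_{m+1}` is spanned by raised vectors `P(x_s) u`, and `⟪v, P(x_s) u⟫ = −conj ⟪N(x_s) v, u⟫`
up to sign (`P* = −N`, `inner_pOp_left`). [cite: BorelWallach2000, II §4.1–4.2] -/
theorem inner_eq_zero_of_null (hU : ∀ (X : (uFormGroup α β).lie) (v w : V), ⟪ρ𝔤 X v, w⟫_ℂ + ⟪v, ρ𝔤 X w⟫_ℂ = 0)
    (hμ : μ * μ = -1) {v : V} (hnull : ∀ s : (α × β) × Fin 2, pOp ρ𝔤 μ (upqPBasis s) v = 0) (m : ℕ) :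
    ∀ {v' : V}, v' ∈ grade ρ𝔤 μ E (m + 1) → ⟪v, v'⟫_ℂ = 0 := by
  intro v' hv'
  rw [grade_succ] at hv'
  refine Submodule.iSup_induction _ (motive := fun v' => ⟪v, v'⟫_ℂ = 0) hv' ?_ (inner_zero_right _) ?_
  · rintro s _ ⟨u, -, rfl⟩
    have hc : conj (-μ) = μ := by rw [map_neg, conj_eq_neg_of_mul_self hμ, neg_neg]
    rw [← inner_conj_symm, inner_pOp_left hU, hc, hnull s, inner_zero_right, neg_zero, map_zero]
  · intro x y hx hy
    rw [inner_add_right, hx, hy, add_zero]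

/-! ## §3 The null vectors of the generated module are exactly the core -/

/-- **A null vector of `gen ρ𝔤 μ E` lies in the core `E`.**  Induction along the filtration: if `v ∈ G₀ ⊔ ⋯ ⊔ G_{m+1}` is null, write `v = u + v′`
with `u ∈ G₀ ⊔ ⋯ ⊔ G_m`, `v′ ∈ G_{m+1}`; then `⟪v, v′⟫ = 0` (null, §2) and `⟪u, v′⟫ = 0` (weights, §2), so `‖v′‖² = 0` and `v = u`.
[cite: BorelWallach2000, II §4.1–4.2] [cite: KnappVogan1995, §II.4] -/
theorem mem_core_of_null (hU : ∀ (X : (uFormGroup α β).lie) (v w : V), ⟪ρ𝔤 X v, w⟫_ℂ + ⟪v, ρ𝔤 X w⟫_ℂ = 0)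
    (hμ : μ * μ = -1) {w : ℂ} (hw : ∀ e ∈ E, ρ𝔤 (upqZ0 α β) e = w • e) {v : V} (hv : v ∈ gen ρ𝔤 μ E)
    (hnull : ∀ s : (α × β) × Fin 2, pOp ρ𝔤 μ (upqPBasis s) v = 0) : v ∈ E := by
  obtain ⟨m, hm⟩ := exists_mem_partialSups_of_mem_gen hv
  -- `∀ m, v ∈ G₀ ⊔ ⋯ ⊔ G_m → v ∈ E` for our null `v`, by induction on `m`
  suffices h : ∀ m : ℕ, v ∈ partialSups (grade ρ𝔤 μ E) m → v ∈ E from h m hm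
  intro m
  induction m with
  | zero => intro h; rwa [partialSups_zero, grade_zero] at h
  | succ m ih =>
    intro h
    rw [partialSups_succ', Submodule.mem_sup] at h
    obtain ⟨u, hu, v', hv', huv⟩ := h
    have h1 : ⟪v, v'⟫_ℂ = 0 := inner_eq_zero_of_null hU hμ hnull m hv'
    have h2 : ⟪u, v'⟫_ℂ = 0 := inner_eq_zero_of_mem_partialSups hU hμ hw m hu (m + 1) (Nat.lt_succ_self m) hv'
    have h3 : ⟪v', v'⟫_ℂ = 0 := by
      have e : v' = v - u := by rw [← huv, add_sub_cancel_left]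
      have h : ⟪v - u, v'⟫_ℂ = ⟪v, v'⟫_ℂ - ⟪u, v'⟫_ℂ := inner_sub_left v u v'
      rw [← e, h1, h2, sub_zero] at h
      exact h
    rw [inner_self_eq_zero.mp h3, add_zero] at huv
    rw [huv] at hu
    exact ih hu

/-- The converse: the core consists of null vectors of `gen` (`hEn`, ★ `le_gen`); so **the null vectors of `gen ρ𝔤 μ E` are EXACTLY `E`**.
[cite: BorelWallach2000, II §4.2] -/
theorem mem_core_iff_null (hU : ∀ (X : (uFormGroup α β).lie) (v w : V), ⟪ρ𝔤 X v, w⟫_ℂ + ⟪v, ρ𝔤 X w⟫_ℂ = 0)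
    (hμ : μ * μ = -1) (hEn : ∀ e ∈ E, ∀ s : (α × β) × Fin 2, pOp ρ𝔤 μ (upqPBasis s) e = 0) {w : ℂ}
    (hw : ∀ e ∈ E, ρ𝔤 (upqZ0 α β) e = w • e) {v : V} (hv : v ∈ gen ρ𝔤 μ E) :
    v ∈ E ↔ ∀ s : (α × β) × Fin 2, pOp ρ𝔤 μ (upqPBasis s) v = 0 :=
  ⟨fun h s => hEn v h s, mem_core_of_null hU hμ hw hv⟩

end Filtration

/-! ## §4 Irreducibility of the module generated by a `K`-irreducible null core -/

section Irreducible

variable {μ : ℂ} {E : Submodule ℂ V}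

/-- A `(𝔤, K)`-submodule containing the core contains the generated module (it is stable under the raising operators). [folklore] -/
theorem gen_le_of_core_le {W : Submodule ℂ V} (hW : IsGKSubmodule ρK ρ𝔤 W) (hEW : E ≤ W) : gen ρ𝔤 μ E ≤ W := by
  have h : ∀ n : ℕ, grade ρ𝔤 μ E n ≤ W := by
    intro n
    induction n with
    | zero => exact hEW
    | succ n ih =>
      rw [grade_succ]
      refine iSup_le fun s => Submodule.map_le_iff_le_comap.mpr fun u hu => ?_
      rw [Submodule.mem_comap, pOp_apply]
      exact Submodule.add_mem _ (hW.2 _ u (ih hu)) (Submodule.smul_mem _ _ (hW.2 _ u (ih hu)))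
  exact iSup_le h

/-- **THE GENERATED MODULE OF A `K`-IRREDUCIBLE NULL CORE IS IRREDUCIBLE** (unitary case).  Let `ρ𝔤` be skew-Hermitian, `μ² = −1`, `E` a null
core (`hEn`, `hEk`, `hEK`) of `z₀`-weight `w` whose only `K`-stable subspaces are `⊥` and `E` (`hEirr`).  Then every `(𝔤, K)`-submodule
`W ≤ gen ρ𝔤 μ E` is `⊥` or `gen ρ𝔤 μ E`.  Proof: if `W ⊓ E = ⊥`, every `v ∈ W ∩ (G₀ ⊔ ⋯ ⊔ G_m)` vanishes by induction on `m` — the `N(x_s) v ∈ W` lie one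
stage lower, hence vanish, so `v` is null, hence in `E` (§3), hence in `W ⊓ E = ⊥`; otherwise `W ⊓ E` is a non-zero `K`-stable subspace of `E`, so
`E ≤ W` and `gen ≤ W`. [cite: BorelWallach2000, II §4.1–4.2] [cite: KnappVogan1995, §II.4] [cite: Rogawski1990, §15.2] -/
theorem eq_bot_or_eq_gen_of_isGKSubmodule
    (hU : ∀ (X : (uFormGroup α β).lie) (v w : V), ⟪ρ𝔤 X v, w⟫_ℂ + ⟪v, ρ𝔤 X w⟫_ℂ = 0) (hμ : μ * μ = -1)
    (hEn : ∀ e ∈ E, ∀ s : (α × β) × Fin 2, pOp ρ𝔤 μ (upqPBasis s) e = 0)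
    (hEk : ∀ W ∈ (uFormGroup α β).kInLie, ∀ e ∈ E, ρ𝔤 W e ∈ E)
    (hEK : ∀ (k : (uFormGroup α β).maximalCompact), ∀ e ∈ E, ρK k e ∈ E)
    {w : ℂ} (hw : ∀ e ∈ E, ρ𝔤 (upqZ0 α β) e = w • e)
    (hEirr : ∀ F : Submodule ℂ V, F ≤ E → (∀ (k : (uFormGroup α β).maximalCompact), ∀ f ∈ F, ρK k f ∈ F) → F = ⊥ ∨ F = E)
    {W : Submodule ℂ V} (hW : IsGKSubmodule ρK ρ𝔤 W) (hWle : W ≤ gen ρ𝔤 μ E) : W = ⊥ ∨ W = gen ρ𝔤 μ E := by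
  rcases hEirr (W ⊓ E) inf_le_right (fun k f hf => ⟨hW.1 k f hf.1, hEK k f hf.2⟩) with hWE | hWE
  · -- `W` misses the core: it is `⊥`
    left
    have key : ∀ (m : ℕ) {v : V}, v ∈ W → v ∈ partialSups (grade ρ𝔤 μ E) m → v = 0 := by
      intro m
      induction m with
      | zero =>
        intro v hvW hv
        rw [partialSups_zero, grade_zero] at hv
        exact (Submodule.mem_bot ℂ).mp (hWE ▸ (Submodule.mem_inf.mpr ⟨hvW, hv⟩ : v ∈ W ⊓ E))
      | succ m ih =>
        intro v hvW hv
        have hnull : ∀ s : (α × β) × Fin 2, pOp ρ𝔤 μ (upqPBasis s) v = 0 := fun s =>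
          ih (by rw [pOp_apply]; exact Submodule.add_mem _ (hW.2 _ v hvW) (Submodule.smul_mem _ _ (hW.2 _ v hvW)))
            (pOp_mem_partialSups hEn hEk _ (upqPBasis_mem_pPart s) m hv)
        have hvE : v ∈ E := mem_core_of_null hU hμ hw (partialSups_le_gen (m + 1) hv) hnull
        exact (Submodule.mem_bot ℂ).mp (hWE ▸ (Submodule.mem_inf.mpr ⟨hvW, hvE⟩ : v ∈ W ⊓ E))
    refine (Submodule.eq_bot_iff _).mpr fun v hvW => ?_
    obtain ⟨m, hm⟩ := exists_mem_partialSups_of_mem_gen (hWle hvW)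
    exact key m hvW hm
  · -- `W` meets the core: it contains it, hence everything
    right
    exact le_antisymm hWle (gen_le_of_core_le hW (hWE ▸ inf_le_left))

/-- **Dichotomy for an arbitrary `(𝔤, K)`-submodule `W` of `V`**: either `W ⊓ gen ρ𝔤 μ E = ⊥` or `gen ρ𝔤 μ E ≤ W` (apply
`eq_bot_or_eq_gen_of_isGKSubmodule` to the `(𝔤, K)`-submodule `W ⊓ gen`, ★ `isGKSubmodule_gen`). [cite: BorelWallach2000, II §4.1–4.2]
[cite: KnappVogan1995, §II.4] -/
theorem inf_gen_eq_bot_or_gen_le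
    (hU : ∀ (X : (uFormGroup α β).lie) (v w : V), ⟪ρ𝔤 X v, w⟫_ℂ + ⟪v, ρ𝔤 X w⟫_ℂ = 0) (hμ : μ * μ = -1)
    (hV : ∀ (k : (uFormGroup α β).maximalCompact) (X : (uFormGroup α β).lie), ρK k ∘ₗ ρ𝔤 X ∘ₗ ρK k⁻¹ =
      ρ𝔤 ((uFormGroup α β).Ad (Subgroup.inclusion (uFormGroup α β).maximalCompact_le_carrier k) X))
    (hEn : ∀ e ∈ E, ∀ s : (α × β) × Fin 2, pOp ρ𝔤 μ (upqPBasis s) e = 0)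
    (hEk : ∀ W ∈ (uFormGroup α β).kInLie, ∀ e ∈ E, ρ𝔤 W e ∈ E)
    (hEK : ∀ (k : (uFormGroup α β).maximalCompact), ∀ e ∈ E, ρK k e ∈ E)
    {w : ℂ} (hw : ∀ e ∈ E, ρ𝔤 (upqZ0 α β) e = w • e)
    (hEirr : ∀ F : Submodule ℂ V, F ≤ E → (∀ (k : (uFormGroup α β).maximalCompact), ∀ f ∈ F, ρK k f ∈ F) → F = ⊥ ∨ F = E)
    {W : Submodule ℂ V} (hW : IsGKSubmodule ρK ρ𝔤 W) : W ⊓ gen ρ𝔤 μ E = ⊥ ∨ gen ρ𝔤 μ E ≤ W := by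
  have hgen := isGKSubmodule_gen hV hEn hEk hEK (μ := μ)
  -- `W ⊓ gen` is a `(𝔤, K)`-submodule (★ `GKSubquot.isGKSubmodule_inf`, inlined to keep the imports light)
  have hinf : IsGKSubmodule ρK ρ𝔤 (W ⊓ gen ρ𝔤 μ E) :=
    ⟨fun k v hv => ⟨hW.1 k v hv.1, hgen.1 k v hv.2⟩, fun X v hv => ⟨hW.2 X v hv.1, hgen.2 X v hv.2⟩⟩
  rcases eq_bot_or_eq_gen_of_isGKSubmodule hU hμ hEn hEk hEK hw hEirr hinf inf_le_right with h | h
  · exact Or.inl h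
  · exact Or.inr (h ▸ inf_le_left)

/-- **The core is the whole lowest piece**: a `K`-stable subspace `F` of `gen ρ𝔤 μ E` consisting of null vectors lies in `E` (§3); in particular a
`(𝔤, K)`-submodule `W ≤ gen` with `W ≠ ⊥` has `W ⊓ E ≠ ⊥` — recorded as: `W ⊓ E = ⊥ → W = ⊥`. [cite: BorelWallach2000, II §4.2] -/
theorem eq_bot_of_inf_core_eq_bot
    (hU : ∀ (X : (uFormGroup α β).lie) (v w : V), ⟪ρ𝔤 X v, w⟫_ℂ + ⟪v, ρ𝔤 X w⟫_ℂ = 0) (hμ : μ * μ = -1)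
    (hEn : ∀ e ∈ E, ∀ s : (α × β) × Fin 2, pOp ρ𝔤 μ (upqPBasis s) e = 0)
    (hEk : ∀ W ∈ (uFormGroup α β).kInLie, ∀ e ∈ E, ρ𝔤 W e ∈ E)
    {w : ℂ} (hw : ∀ e ∈ E, ρ𝔤 (upqZ0 α β) e = w • e)
    {W : Submodule ℂ V} (hW𝔤 : ∀ (X : (uFormGroup α β).lie), ∀ v ∈ W, ρ𝔤 X v ∈ W) (hWle : W ≤ gen ρ𝔤 μ E) (hWE : W ⊓ E = ⊥) :
    W = ⊥ := by
  have key : ∀ (m : ℕ) {v : V}, v ∈ W → v ∈ partialSups (grade ρ𝔤 μ E) m → v = 0 := by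
    intro m
    induction m with
    | zero =>
      intro v hvW hv
      rw [partialSups_zero, grade_zero] at hv
      exact (Submodule.mem_bot ℂ).mp (hWE ▸ (Submodule.mem_inf.mpr ⟨hvW, hv⟩ : v ∈ W ⊓ E))
    | succ m ih =>
      intro v hvW hv
      have hnull : ∀ s : (α × β) × Fin 2, pOp ρ𝔤 μ (upqPBasis s) v = 0 := fun s =>
        ih (by rw [pOp_apply]; exact Submodule.add_mem _ (hW𝔤 _ v hvW) (Submodule.smul_mem _ _ (hW𝔤 _ v hvW)))
          (pOp_mem_partialSups hEn hEk _ (upqPBasis_mem_pPart s) m hv)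
      have hvE : v ∈ E := mem_core_of_null hU hμ hw (partialSups_le_gen (m + 1) hv) hnull
      exact (Submodule.mem_bot ℂ).mp (hWE ▸ (Submodule.mem_inf.mpr ⟨hvW, hvE⟩ : v ∈ W ⊓ E))
  refine (Submodule.eq_bot_iff _).mpr fun v hvW => ?_
  obtain ⟨m, hm⟩ := exists_mem_partialSups_of_mem_gen (hWle hvW)
  exact key m hvW hm

end Irreducible

end Summit.HodgeConjecture.HodgeConjecture.Cruxes.H413.F0P3GenIrreducibleOfUnitary

end
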